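import Summits.PneNP.PneNP.Theses.PrimalityPlaces
import Summits.PneNP.StrongHypotheses
import Literature.Computability.Complexity.ProofComplexity

/-!
# REDIRECT r1 — t1c supplement for crux `EFPrimalityHard` (stmt-PneNP-16927)

The tribunal's full tier (2026-08-17T16:39Z, advisory-jail) reported `t1_kernel=clean` for `EFPrimalityHard`
but `t1c:timeout:…:27-bridged-hypotheses-uncovered` (only pass A ran for ranks 10–28 within the 31 s budget).
This file re-runs the dominance test `H → EFPrimalityHard` by hand, with a longer battery, for the registered
strong hypotheses that are thematically closest to the crux (proof complexity / factoring / circuit lower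
bounds), plus the nearest UNREGISTERED open statement `EFNotPolyBounded` (Cook–Reckhow; listed in
`Literature/StrongHypotheses/PneNP.lean` §"Not registered" as NOT known to imply `P ≠ NP`).
Self-certifying form as in `RedirectProbesR1.lean`: every probe ends in `| sorry`; the number of
`declaration uses 'sorry'` warnings = the number of probes whose battery failed (expected: all of D1–D8).
  D1  TautHasNoPolyBoundedProofSystem → C      D2  NPNeCoNP → C
  D3  KrajicekGeneratorConjecture → C          D4  FactoringNotInP → C
  D5  NPNotSubsetPPoly → C                     D6  SATNotInP → C   (≡ S → C in criterion form)
  D7  EFNotPolyBounded → C   ("SOME family is EF-hard" does not give "σ_p is EF-hard")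
  D8  C → EFNotPolyBounded   (TRUE — support item `EFPrimalityGivesEFNotPolyBounded` modulo the size
                              estimate |σ_p| = O(n²) — but not by a cheap tactic; shows C sits at/below pnp.S32)
-/

set_option maxHeartbeats 400000

open Summit.PneNP.PneNP.Theses
open Literature.StrongHypotheses.PneNP
open Literature.Computability.Complexity (EFNotPolyBounded)

namespace RedirectR1.Dominance

abbrev C : Prop := PrimalityPlaces.EFPrimalityHard

-- D1
example : TautHasNoPolyBoundedProofSystem → C := by
  first | exact? | (intro h; simp only [C, PrimalityPlaces.EFPrimalityHard, TautHasNoPolyBoundedProofSystem] at h ⊢; tauto) | tauto | (aesop (config := { terminal := true, warnOnNonterminal := false })) | sorry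
-- D2
example : NPNeCoNP → C := by
  first | exact? | (intro h; simp only [C, PrimalityPlaces.EFPrimalityHard, NPNeCoNP] at h ⊢; tauto) | tauto | (aesop (config := { terminal := true, warnOnNonterminal := false })) | sorry
-- D3
example : KrajicekGeneratorConjecture → C := by
  first | exact? | (intro h; simp only [C, PrimalityPlaces.EFPrimalityHard, KrajicekGeneratorConjecture] at h ⊢; tauto) | tauto | (aesop (config := { terminal := true, warnOnNonterminal := false })) | sorry
-- D4
example : FactoringNotInP → C := by
  first | exact? | (intro h; simp only [C, PrimalityPlaces.EFPrimalityHard, FactoringNotInP] at h ⊢; tauto) | tauto | (aesop (config := { terminal := true, warnOnNonterminal := false })) | sorry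
-- D5
example : Summit.PneNP.PneNP.NPNotSubsetPPoly → C := by
  first | exact? | (intro h; simp only [C, PrimalityPlaces.EFPrimalityHard, Summit.PneNP.PneNP.NPNotSubsetPPoly] at h ⊢; tauto) | tauto | (aesop (config := { terminal := true, warnOnNonterminal := false })) | sorry
-- D6
example : SATNotInP → C := by
  first | exact? | (intro h; simp only [C, PrimalityPlaces.EFPrimalityHard, SATNotInP] at h ⊢; tauto) | tauto | (aesop (config := { terminal := true, warnOnNonterminal := false })) | sorry
-- D7
example : EFNotPolyBounded → C := by
  first | exact? | (intro h; simp only [C, PrimalityPlaces.EFPrimalityHard, EFNotPolyBounded] at h ⊢; tauto) | tauto | (aesop (config := { terminal := true, warnOnNonterminal := false })) | sorry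
-- D8
example : C → EFNotPolyBounded := by
  first | exact? | (intro h; simp only [C, PrimalityPlaces.EFPrimalityHard, EFNotPolyBounded] at h ⊢; tauto) | tauto | (aesop (config := { terminal := true, warnOnNonterminal := false })) | sorry

end RedirectR1.Dominance
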